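import Mathlib.Analysis.ODE.Gronwall
import Mathlib.Analysis.Complex.ExponentialBounds
import Mathlib.Analysis.Calculus.FDeriv.Symmetric
import Mathlib.Analysis.Calculus.FDeriv.CompCLM
import Literature.Analysis.ODE.TorusBackwardFlow
import Literature.Analysis.FunctionSpaces.TorusSpaceTimeKernel
import Literature.Analysis.FluidPDE.OnsagerBDSVPerturbation
import HarnessLib

/-!
# The BDSV scheme: transport estimates along a smooth velocity field (App. B, Prop. B.1)

Buckmaster–De Lellis–Székelyhidi–Vicol (BDSV), *Onsager's conjecture for admissible weak
solutions*, CPAM 72 (2019) = arXiv:1701.08678, App. B "Estimates for transport equations",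
Prop. B.1: for a smooth velocity field `v` and a solution `f` of `∂ₜf + v·∇f = g`,
(B.1) `‖f(t)‖₀ ≤ ‖f(t₀)‖₀ + ∫‖g‖₀`; and for the inverse flux `Φ` (the backward flow,
`(∂ₜ + v·∇)Φ = 0`, `Φ(t₀, ·) = id`), under `|t - t₀| ‖v‖₁ ≤ 1`,
(B.4) `‖∇Φ(t) - Id‖₀ ≲ |t - t₀| [v]₁` and (B.5) `[Φ(t)]_N ≲ |t - t₀| [v]_N`, `N ≥ 2`
("we will consider solutions on the entire space `ℝ³` and treat solutions on the torus simply
as periodic solutions in `ℝ³`"; "standard estimates", proof referred to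
Buckmaster–De Lellis–Isett–Székelyhidi 2015). This file PROVES them on `[0,T] × T³` in the form
consumed by the perturbation estimates of §5 (Lemma 5.4 (5.12), Prop. 5.7 (5.29)):

* `BDSV.norm_le_gronwallBound_of_advectiveDeriv` — (B.1) with a linear term: if `F` and `v` are
  jointly smooth on `[0,T] × T³` and `‖(∂ₜ + v·∇)F‖ ≤ K‖F‖ + ε` pointwise between `t₀` and `t`,
  then `‖F(t, x)‖ ≤ gronwallBound ‖F(t₀)‖₀ K ε |t - t₀|` (method of characteristics: the
  characteristics are the integral curves of the suspended lifted field of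
  `Literature/Analysis/ODE/TorusBackwardFlow.lean`, along which `F` solves a linear ODE
  inequality; Mathlib's Grönwall bound `norm_le_gronwallBound_of_norm_deriv_right_le`);
* `BDSV.gradField u = ∇u`, the field of spatial Fréchet derivatives of the slices, and the
  commutation rule `∇[(∂ₜ + v·∇)u] = (∂ₜ + v·∇)∇u + ∇u ∘ ∇v` (`BDSV.gradField_advectiveDeriv`;
  mixed partials of the jointly smooth lift commute within `[0,T] × ℝ³`, and the second
  spatial derivative is symmetric);
* `BDSV.norm_gradField_le`, `BDSV.norm_gradField_two_le`, `BDSV.norm_gradField_three_le` —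
  (B.4)–(B.5) for `N ≤ 3`: for a displacement `D` with `(∂ₜ + v·∇)D = -v` on `[0,T] × T³` and
  `D(t₀, ·) = 0` (so `Φ = id + D`, `∇Φ - Id = ∇D`), and `sup ‖∇ᵏv‖ ≤ V_k` (`k = 1, 2, 3`),
  `|t - t₀| V₁ ≤ 1`: `‖∇D(t)‖₀ ≤ 3 V₁ |t - t₀|`, `‖∇²D(t)‖₀ ≤ 32 V₂ |t - t₀|`,
  `‖∇³D(t)‖₀ ≤ 2100 (V₃ + V₂² |t - t₀|) |t - t₀|` (Grönwall three times, each derivative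
  solving `(∂ₜ + v·∇)∇ᵏD = -∇ᵏv - Σ ∇ʲD ⋆ ∇ᵏ⁺¹⁻ʲv`), also re-expressed through
  `iteratedFDeriv ℝ k (Torus.lift (D t))` (`BDSV.norm_iteratedFDeriv_lift_le_of_transport`), the
  form used with `BDSV.HolderSupLE` hypotheses, and specialised to `BDSV.FlowDisplacement`
  (`BDSV.FlowDisplacement.norm_iteratedFDeriv_lift_le`).

Constants are explicit but not optimised (the source has `≲`).

## References

* T. Buckmaster, C. De Lellis, L. Székelyhidi Jr., V. Vicol, *Onsager's conjecture for admissible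
  weak solutions*, Comm. Pure Appl. Math. 72 (2019) 229–274 = arXiv:1701.08678, App. B,
  Prop. B.1, (B.1), (B.4), (B.5); §5.2 (backward flows `Φᵢ`), Lemma 5.4 (5.12), Prop. 5.7 (5.29).
* T. Buckmaster, C. De Lellis, P. Isett, L. Székelyhidi Jr., *Anomalous dissipation for
  `1/5`-Hölder Euler flows*, Ann. of Math. 182 (2015), App. (transport estimates; the reference
  `[BDLISZ15]` of Prop. B.1).
-/

open Set Filter Metric
open scoped Topology NNReal ContDiff

noncomputable section

namespace Literature.Analysis.FluidPDE

namespace BDSV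

open FunctionSpaces FunctionSpaces.Torus Literature.Analysis.ODE

/-- The flat three-torus `T³ = (ℝ/ℤ)³`, local notation. -/
local notation "𝕋³" => UnitAddTorus (Fin 3)

/-- Euclidean `ℝ³`, local notation. -/
local notation "ℝ³" => EuclideanSpace ℝ (Fin 3)

variable {E : Type*} [NormedAddCommGroup E] [NormedSpace ℝ E]

/-! ## (B.1): a Grönwall bound along characteristics -/

section Characteristics

variable {T : ℝ} {v : ℝ → 𝕋³ → ℝ³} {F : ℝ → 𝕋³ → E}

/-- `advectiveDeriv T v F t x = ∂ₜF(t,x) + D(F t)(x)[v(t,x)]`, unfolded. [folklore] -/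
theorem advectiveDeriv_apply (T : ℝ) (v : ℝ → 𝕋³ → ℝ³) (F : ℝ → 𝕋³ → E) (t : ℝ) (x : 𝕋³) :
    advectiveDeriv T v F t x = timeDerivWithin (Icc 0 T) F t x + Torus.fderiv (F t) x (v t x) :=
  rfl

/-- **(B.1) with a linear term, by the method of characteristics.** Let `v` and `F` be jointly
smooth on `[0,T] × T³` (`T > 0`), `t₀, t ∈ [0,T]`, `‖F(t₀, ·)‖ ≤ δ`, and
`‖(∂ₜ + v·∇)F(s, ·)‖ ≤ K ‖F(s, ·)‖ + ε` pointwise for `s` between `t₀` and `t`. Then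
`‖F(t, x)‖ ≤ gronwallBound δ K ε |t - t₀|` for every `x` (for `K = 0` this is
`δ + ε|t - t₀|`, i.e. (B.1); in general `δ e^{K|t-t₀|} + (ε/K)(e^{K|t-t₀|} - 1)`). Proof: along
the characteristic `X` through `(t, x)` (an integral curve of the lifted field, which exists on
all of `[0,T]`), `h(s) = F(s, X(s))` satisfies `h' = ((∂ₜ + v·∇)F)(s, X(s))`, and Grönwall's
inequality applies between `t₀` and `t`. [cite: BuckmasterEtAl2018, App. B, Prop. B.1 (B.1)] -/
theorem norm_le_gronwallBound_of_advectiveDeriv (hT : 0 < T)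
    (hv : IsSmoothSpaceTimeOn (Icc 0 T) v) (hF : IsSmoothSpaceTimeOn (Icc 0 T) F)
    {t₀ t : ℝ} (ht₀ : t₀ ∈ Icc 0 T) (ht : t ∈ Icc 0 T) {δ K ε : ℝ}
    (hδ : ∀ x, ‖F t₀ x‖ ≤ δ)
    (hb : ∀ s ∈ uIcc t₀ t, ∀ x, ‖advectiveDeriv T v F s x‖ ≤ K * ‖F s x‖ + ε) (x : 𝕋³) :
    ‖F t x‖ ≤ gronwallBound δ K ε |t - t₀| := by
  classical
  obtain ⟨y, rfl⟩ := proj_surjective x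
  -- the suspended lifted field and its global flow
  obtain ⟨K₀, hK₀⟩ := BackwardFlow.exists_lipschitzWith_clampedLift hT hv
  obtain ⟨B₀, hB₀⟩ := BackwardFlow.exists_bound_clampedLift hT hv
  have hK := lipschitzWith_suspension hK₀
  have hL := norm_suspension_le hB₀
  set S : Set ℝ := Icc 0 T with hSdef
  have hS : UniqueDiffOn ℝ S := uniqueDiffOn_Icc hT
  -- the characteristic through `(t, y)`
  set Γ : ℝ → ℝ × ℝ³ := fun s => globalFlow hK hL (t, y) (s - t) with hΓdef
  have hΓt : Γ t = (t, y) := by simp [hΓdef]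
  have hΓ1 : ∀ s, (Γ s).1 = s := fun s => by
    rw [hΓdef]
    simp only
    rw [BackwardFlow.fst_globalFlow_suspension]
    ring
  have hΓd : ∀ s, HasDerivAt Γ (suspension (BackwardFlow.clampedLift hT.le v) (Γ s)) s := by
    intro s
    have h := (hasDerivAt_globalFlow hK hL (t, y) (s - t)).scomp s ((hasDerivAt_id s).sub_const t)
    rwa [one_smul] at h
  have hΓmem : ∀ s ∈ S, Γ s ∈ S ×ˢ (univ : Set ℝ³) := fun s hs => by
    have h1 : (Γ s).1 ∈ S := by rw [hΓ1]; exact hs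
    exact mk_mem_prod h1 (mem_univ _)
  -- `h = F ∘ characteristic` and its derivative within `[0,T]`
  set h : ℝ → E := fun s => stLift F (Γ s) with hhdef
  have hhF : ∀ s, h s = F s (proj (Γ s).2) := fun s => by
    change F (Γ s).1 (proj (Γ s).2) = _
    rw [hΓ1]
  have hderiv : ∀ s ∈ S, HasDerivWithinAt h (advectiveDeriv T v F s (proj (Γ s).2)) S s := by
    intro s hs
    have h1 : HasFDerivWithinAt (stLift F) (stDeriv S F s (proj (Γ s).2)) (S ×ˢ univ) (Γ s) := by
      have := hF.hasFDerivWithinAt_stLift hS hs (Γ s).2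
      rwa [show ((s, (Γ s).2) : ℝ × ℝ³) = Γ s from Prod.ext (hΓ1 s).symm rfl] at this
    have h2 : HasDerivWithinAt Γ (suspension (BackwardFlow.clampedLift hT.le v) (Γ s)) S s :=
      (hΓd s).hasDerivWithinAt
    have h3 := h1.comp_hasDerivWithinAt s h2 fun σ hσ => hΓmem σ hσ
    have hsusp : suspension (BackwardFlow.clampedLift hT.le v) (Γ s) = (1, stLift v (Γ s)) :=
      BackwardFlow.suspension_clampedLift_of_mem (by rw [hΓ1]; exact hs)
    rw [hsusp, stDeriv_apply, one_smul] at h3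
    have h4 : HasDerivWithinAt h (timeDerivWithin S F s (proj (Γ s).2) +
        Torus.fderiv (F s) (proj (Γ s).2) (stLift v (Γ s))) S s := h3
    refine h4.congr_deriv ?_
    have e : stLift v (Γ s) = v s (proj (Γ s).2) := by
      change v (Γ s).1 (proj (Γ s).2) = _
      rw [hΓ1]
    rw [e, advectiveDeriv_apply]
  have hcont : ContinuousOn h S := fun s hs => (hderiv s hs).continuousWithinAt
  have hbound : ∀ s ∈ S, s ∈ uIcc t₀ t →
      ‖advectiveDeriv T v F s (proj (Γ s).2)‖ ≤ K * ‖h s‖ + ε := fun s _ hs' => by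
    rw [hhF]; exact hb s hs' _
  have hfinal : ‖h t‖ ≤ gronwallBound δ K ε |t - t₀| := by
    rcases le_total t₀ t with htt | htt
    · -- forward in time: Grönwall on `[t₀, t]`
      have hsub : Icc t₀ t ⊆ S := Icc_subset_Icc ht₀.1 ht.2
      have key := norm_le_gronwallBound_of_norm_deriv_right_le (f := h)
        (f' := fun s => advectiveDeriv T v F s (proj (Γ s).2)) (δ := δ) (K := K) (ε := ε)
        (a := t₀) (b := t) (hcont.mono hsub) ?_ ?_ ?_ t (right_mem_Icc.2 htt)
      · rwa [abs_of_nonneg (sub_nonneg.2 htt)]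
      · intro s hs
        have hsS : s ∈ S := hsub (Ico_subset_Icc_self hs)
        refine (hderiv s hsS).mono_of_mem_nhdsWithin ?_
        have hsT : s < T := lt_of_lt_of_le hs.2 ht.2
        exact mem_of_superset (Icc_mem_nhdsGE hsT) (Icc_subset_Icc hsS.1 le_rfl)
      · rw [hhF, show (Γ t₀).2 = (Γ t₀).2 from rfl]
        exact hδ _
      · intro s hs
        exact hbound s (hsub (Ico_subset_Icc_self hs)) (by rw [uIcc_of_le htt]; exact Ico_subset_Icc_self hs)
    · -- backward in time: Grönwall on `[0, t₀ - t]` for `r ↦ h (t₀ - r)`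
      have hsub : Icc t t₀ ⊆ S := Icc_subset_Icc ht.1 ht₀.2
      set g : ℝ → E := fun r => h (t₀ - r) with hgdef
      have key := norm_le_gronwallBound_of_norm_deriv_right_le (f := g)
        (f' := fun r => -advectiveDeriv T v F (t₀ - r) (proj (Γ (t₀ - r)).2)) (δ := δ) (K := K)
        (ε := ε) (a := 0) (b := t₀ - t) ?_ ?_ ?_ ?_ (t₀ - t) (right_mem_Icc.2 (sub_nonneg.2 htt))
      · rw [abs_of_nonpos (sub_nonpos.2 htt), neg_sub]
        simpa [hgdef] using key
      · refine hcont.comp (continuousOn_const.sub continuousOn_id) fun r hr => hsub ⟨?_, ?_⟩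
        · linarith [hr.2]
        · linarith [hr.1]
      · intro r hr
        have hσ : t₀ - r ∈ Ioc t t₀ := ⟨by linarith [hr.2], by linarith [hr.1]⟩
        have hσS : t₀ - r ∈ S := hsub (Ioc_subset_Icc_self hσ)
        have h1 : HasDerivWithinAt h (advectiveDeriv T v F (t₀ - r) (proj (Γ (t₀ - r)).2))
            (Iic (t₀ - r)) (t₀ - r) := by
          refine (hderiv _ hσS).mono_of_mem_nhdsWithin ?_
          have h0σ : t < t₀ - r := hσ.1
          exact mem_of_superset (Icc_mem_nhdsLE (lt_of_le_of_lt ht.1 h0σ))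
            (Icc_subset_Icc le_rfl hσS.2)
        have h2 : HasDerivWithinAt (fun r : ℝ => t₀ - r) (-1 : ℝ) (Ici r) r := by
          simpa using ((hasDerivWithinAt_id r (Ici r)).const_sub t₀)
        have h3 := h1.scomp r h2 fun r' hr' => show t₀ - r' ≤ t₀ - r by
          simp only [mem_Ici] at hr'; linarith
        have h4 : HasDerivWithinAt g ((-1 : ℝ) • advectiveDeriv T v F (t₀ - r) (proj (Γ (t₀ - r)).2))
            (Ici r) r := h3
        simpa using h4
      · change ‖h (t₀ - 0)‖ ≤ δ
        rw [sub_zero, hhF]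
        exact hδ _
      · intro r hr
        have hσ : t₀ - r ∈ Icc t t₀ := ⟨by linarith [hr.2], by linarith [hr.1]⟩
        rw [norm_neg]
        exact hbound _ (hsub hσ) (by rw [uIcc_of_ge htt]; exact hσ)
  have hΓt2 : (Γ t).2 = y := by rw [hΓt]
  rw [hhF, hΓt2] at hfinal
  exact hfinal

end Characteristics

/-! ## Spatial gradients of space–time fields and the commutation rule -/

section GradField

variable {E' : Type*} [NormedAddCommGroup E'] [NormedSpace ℝ E']

/-- The field of spatial Fréchet derivatives of the time slices, `∇u (t, x) = D(u t)(x)`, a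
continuous linear map `ℝ³ →L E` (for `u = Φ - id` this is `∇Φ - Id` of (B.4)). [folklore] -/
def gradField (u : ℝ → 𝕋³ → E) : ℝ → 𝕋³ → (ℝ³ →L[ℝ] E) := fun t x => Torus.fderiv (u t) x

/-- `gradField u t x = D(u t)(x)`. [folklore] -/
@[simp] theorem gradField_apply (u : ℝ → 𝕋³ → E) (t : ℝ) (x : 𝕋³) :
    gradField u t x = Torus.fderiv (u t) x := rfl

/-- The lift of a spatial derivative slice is the derivative of the lift. [folklore] -/
theorem lift_fderiv_slice (f : 𝕋³ → E) :
    lift (fun x => Torus.fderiv f x) = _root_.fderiv ℝ (lift f) := by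
  funext y
  rw [lift_apply, fderiv_lift]

/-- The lift of `gradField u t` is the derivative of the lift of `u t`. [folklore] -/
theorem lift_gradField (u : ℝ → 𝕋³ → E) (t : ℝ) :
    lift (gradField u t) = _root_.fderiv ℝ (lift (u t)) :=
  lift_fderiv_slice (u t)

/-- The spatial derivative of a smooth slice is a smooth slice. [folklore] -/
theorem _root_.Literature.Analysis.FunctionSpaces.Torus.IsSmooth.fderiv_slice {f : 𝕋³ → E}
    (hf : IsSmooth f) : IsSmooth (fun x => Torus.fderiv f x) := by
  unfold IsSmooth
  rw [lift_fderiv_slice]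
  exact hf.fderiv_right le_rfl

/-- Spatial gradients of jointly smooth fields are jointly smooth (on time sets of unique
differentiability): the lift of `∇u` is `z ↦ D_{S × ℝ³}(stLift u)(z) ∘ inr`. [folklore] -/
theorem _root_.Literature.Analysis.FunctionSpaces.Torus.IsSmoothSpaceTimeOn.gradField
    {S : Set ℝ} {u : ℝ → 𝕋³ → E} (hu : IsSmoothSpaceTimeOn S u) (hS : UniqueDiffOn ℝ S) :
    IsSmoothSpaceTimeOn S (gradField u) := by
  have hU : UniqueDiffOn ℝ (S ×ˢ (univ : Set ℝ³)) := hS.prod uniqueDiffOn_univ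
  have hG : ContDiffOn ℝ ∞ (fun z => (fderivWithin ℝ (stLift u) (S ×ˢ univ) z).comp
      (ContinuousLinearMap.inr ℝ ℝ ℝ³)) (S ×ˢ (univ : Set ℝ³)) :=
    (hu.fderivWithin hU le_rfl).clm_comp contDiffOn_const
  refine hG.congr fun z hz => ?_
  obtain ⟨t, y⟩ := z
  have ht : t ∈ S := (mem_prod.1 hz).1
  refine ContinuousLinearMap.ext fun w => ?_
  rw [stLift_apply, gradField_apply, hu.fderiv_slice_apply ht y w]
  rfl

/-- `D(L ∘ f)(x) = L ∘ D f(x)` on the torus, for a continuous linear `L` and `C¹` `f`. [folklore] -/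
theorem _root_.Literature.Analysis.FunctionSpaces.Torus.fderiv_clm_comp_slice {f : 𝕋³ → E}
    (hf : IsContDiff 1 f) (L : E →L[ℝ] E') (x : 𝕋³) :
    Torus.fderiv (fun y => L (f y)) x = L.comp (Torus.fderiv f x) := by
  obtain ⟨y, rfl⟩ := proj_surjective x
  rw [← fderiv_lift, ← fderiv_lift]
  have h : lift (fun y => L (f y)) = L ∘ lift f := rfl
  rw [h]
  exact (L.hasFDerivAt.comp y ((hf.differentiable one_ne_zero) y).hasFDerivAt).fderiv

/-- Time derivatives commute with evaluation of a continuous-linear-map-valued field. [folklore] -/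
theorem timeDerivWithin_clm_apply {S : Set ℝ} {G : ℝ → 𝕋³ → (E →L[ℝ] E')}
    (hG : IsSmoothSpaceTimeOn S G) (hS : UniqueDiffOn ℝ S) {t : ℝ} (ht : t ∈ S) (x : 𝕋³) (w : E) :
    timeDerivWithin S G t x w = timeDerivWithin S (fun s y => G s y w) t x := by
  unfold timeDerivWithin
  exact (((ContinuousLinearMap.apply ℝ E' w).hasFDerivAt.comp_hasDerivWithinAt t
    (hG.hasDerivWithinAt_slice ht x))).derivWithin (hS t ht) |>.symm

/-- **`∂ₜ∇ = ∇∂ₜ` for jointly smooth fields on `[a,b] × T³`** (one-sided in time at the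
endpoints): the second derivative of the space–time lift within `[a,b] × ℝ³` is symmetric
(Mathlib's `ContDiffWithinAt.isSymmSndFDerivWithinAt`), and its `((1,0),(0,w))` and
`((0,w),(1,0))` entries are the two mixed derivatives. [folklore] -/
theorem timeDerivWithin_gradField {a b : ℝ} (hab : a < b) {u : ℝ → 𝕋³ → E}
    (hu : IsSmoothSpaceTimeOn (Icc a b) u) {t : ℝ} (ht : t ∈ Icc a b) (x : 𝕋³) :
    timeDerivWithin (Icc a b) (gradField u) t x = gradField (timeDerivWithin (Icc a b) u) t x := by
  obtain ⟨y, rfl⟩ := proj_surjective x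
  set S : Set ℝ := Icc a b with hSdef
  set S' : Set (ℝ × ℝ³) := S ×ˢ univ with hS'def
  have hS : UniqueDiffOn ℝ S := uniqueDiffOn_Icc hab
  have hS' : UniqueDiffOn ℝ S' := hS.prod uniqueDiffOn_univ
  set Ψ : ℝ → 𝕋³ → (ℝ × ℝ³ →L[ℝ] E) := stDeriv S u with hΨdef
  have hΨ : IsSmoothSpaceTimeOn S Ψ := hu.stDeriv hS
  have hty : (t, y) ∈ S' := mk_mem_prod ht (mem_univ _)
  have hD1 : EqOn (fderivWithin ℝ (stLift u) S') (stLift Ψ) S' := by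
    rintro ⟨s, z⟩ hp
    exact hu.fderivWithin_stLift hS (mem_prod.1 hp).1 z
  have hD2 : fderivWithin ℝ (fderivWithin ℝ (stLift u) S') S' (t, y) = stDeriv S Ψ t (proj y) := by
    rw [fderivWithin_congr hD1 (hD1 hty)]
    exact hΨ.fderivWithin_stLift hS ht y
  have hsymm : IsSymmSndFDerivWithinAt ℝ (stLift u) S' (t, y) := by
    have h22 : minSmoothness ℝ 2 ≤ ((⊤ : ℕ∞) : ℕ∞ω) := by
      rw [minSmoothness_of_isRCLikeNormedField]
      exact WithTop.coe_le_coe.mpr le_top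
    refine (hu (t, y) hty).isSymmSndFDerivWithinAt h22 hS' ?_ hty
    have hcl : closure (interior S') = S' := by
      rw [hS'def, interior_prod_eq, interior_univ, closure_prod_eq, closure_univ, hSdef, interior_Icc,
        closure_Ioo hab.ne]
    rw [hcl]
    exact hty
  refine ContinuousLinearMap.ext fun w => ?_
  have key := hsymm.eq ((1 : ℝ), (0 : ℝ³)) ((0 : ℝ), w)
  rw [hD2, stDeriv_apply_one_zero, stDeriv_apply, zero_smul, zero_add] at key
  -- `key : timeDerivWithin S Ψ t (proj y) (0, w) = Torus.fderiv (Ψ t) (proj y) w (1, 0)`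
  have hG : IsSmoothSpaceTimeOn S (gradField u) := hu.gradField hS
  -- left-hand side
  have hL : timeDerivWithin S (gradField u) t (proj y) w = timeDerivWithin S Ψ t (proj y) ((0 : ℝ), w) := by
    rw [timeDerivWithin_clm_apply hG hS ht, timeDerivWithin_clm_apply hΨ hS ht]
    congr 1
    funext s z
    rw [hΨdef, stDeriv_apply, zero_smul, zero_add, gradField_apply]
  -- right-hand side
  have hR : gradField (timeDerivWithin S u) t (proj y) w =
      Torus.fderiv (Ψ t) (proj y) w ((1 : ℝ), (0 : ℝ³)) := by
    have e1 : timeDerivWithin S u t =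
        fun z => (ContinuousLinearMap.apply ℝ E ((1 : ℝ), (0 : ℝ³))) (Ψ t z) := by
      funext z
      simp [hΨdef]
    rw [gradField_apply, e1, fderiv_clm_comp_slice ((hΨ.isSmooth_slice ht).isContDiff (by simp))]
    rfl
  rw [hL, hR, key]

/-- **Gradient of a convective derivative**: for smooth slices `f : T³ → E`, `u : T³ → ℝ³`,
`∇[(u·∇)f](x) = (u·∇)(∇f)(x) + ∇f(x) ∘ ∇u(x)` (product rule, and symmetry of the second
derivative of the lift). [folklore] -/
theorem fderiv_convect_slice {f : 𝕋³ → E} {u : 𝕋³ → ℝ³} (hf : IsSmooth f) (hu : IsSmooth u)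
    (x : 𝕋³) :
    Torus.fderiv (convect u f) x =
      convect u (fun y => Torus.fderiv f y) x + (Torus.fderiv f x).comp (Torus.fderiv u x) := by
  obtain ⟨y, rfl⟩ := proj_surjective x
  have hf' : ContDiff ℝ ∞ (lift f) := hf
  have hu' : ContDiff ℝ ∞ (lift u) := hu
  have hlift : lift (convect u f) = fun z => (_root_.fderiv ℝ (lift f) z) (lift u z) := by
    funext z
    rw [lift_apply, convect, ← fderiv_lift, lift_apply]
  have hc : DifferentiableAt ℝ (_root_.fderiv ℝ (lift f)) y :=
    ((hf'.fderiv_right (m := ∞) le_rfl).differentiable (by simp)).differentiableAt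
  have hud : DifferentiableAt ℝ (lift u) y := (hu'.differentiable (by simp)).differentiableAt
  rw [← fderiv_lift, hlift, fderiv_clm_apply hc hud]
  have hsymm : IsSymmSndFDerivAt ℝ (lift f) y := by
    refine (hf'.contDiffAt (x := y)).isSymmSndFDerivAt ?_
    rw [minSmoothness_of_isRCLikeNormedField]
    exact WithTop.coe_le_coe.mpr le_top
  rw [add_comm]
  congr 1
  · -- the second-derivative term
    refine ContinuousLinearMap.ext fun w => ?_
    rw [ContinuousLinearMap.flip_apply, hsymm.eq w (lift u y), convect, ← fderiv_lift, lift_apply,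
      lift_fderiv_slice]
  · rw [← fderiv_lift, ← fderiv_lift]

/-- Slices of the advective derivative of a jointly smooth field are smooth. [folklore] -/
theorem isSmooth_advectiveDeriv_slice {T : ℝ} (hT : 0 < T) {v : ℝ → 𝕋³ → ℝ³} {u : ℝ → 𝕋³ → E}
    (hv : IsSmoothSpaceTimeOn (Icc 0 T) v) (hu : IsSmoothSpaceTimeOn (Icc 0 T) u) {t : ℝ}
    (ht : t ∈ Icc 0 T) : IsSmooth (advectiveDeriv T v u t) :=
  (hu.isSmooth_timeDerivWithin (uniqueDiffOn_Icc hT) ht).add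
    ((hv.isSmooth_slice ht).convect (hu.isSmooth_slice ht))

/-- The advective derivative of a jointly smooth field is jointly smooth. [folklore] -/
theorem _root_.Literature.Analysis.FunctionSpaces.Torus.IsSmoothSpaceTimeOn.advectiveDeriv
    {T : ℝ} (hT : 0 < T) {v : ℝ → 𝕋³ → ℝ³} {u : ℝ → 𝕋³ → E}
    (hv : IsSmoothSpaceTimeOn (Icc 0 T) v) (hu : IsSmoothSpaceTimeOn (Icc 0 T) u) :
    IsSmoothSpaceTimeOn (Icc 0 T) (advectiveDeriv T v u) :=
  (hu.timeDerivWithin (uniqueDiffOn_Icc hT)).add (hv.convect hu (uniqueDiffOn_Icc hT))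

/-- **`∇(∂ₜ + v·∇)u = (∂ₜ + v·∇)∇u + ∇u ∘ ∇v`** on `[0,T] × T³` for jointly smooth `u`, `v`
(the identity behind "`D_{t,q}∇Φᵢ = -∇Φᵢ Dv̄_q`", proof of Prop. 5.9, and behind (B.4)–(B.5)).
[cite: BuckmasterEtAl2018, App. B, Prop. B.1 (B.4)] -/
theorem gradField_advectiveDeriv {T : ℝ} (hT : 0 < T) {v : ℝ → 𝕋³ → ℝ³} {u : ℝ → 𝕋³ → E}
    (hv : IsSmoothSpaceTimeOn (Icc 0 T) v) (hu : IsSmoothSpaceTimeOn (Icc 0 T) u) {t : ℝ}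
    (ht : t ∈ Icc 0 T) (x : 𝕋³) :
    gradField (advectiveDeriv T v u) t x =
      advectiveDeriv T v (gradField u) t x + (gradField u t x).comp (gradField v t x) := by
  have hS : UniqueDiffOn ℝ (Icc 0 T) := uniqueDiffOn_Icc hT
  have h1 : IsSmooth (timeDerivWithin (Icc 0 T) u t) := hu.isSmooth_timeDerivWithin hS ht
  have h2 : IsSmooth (convect (v t) (u t)) := (hv.isSmooth_slice ht).convect (hu.isSmooth_slice ht)
  obtain ⟨y, rfl⟩ := proj_surjective x
  rw [gradField_apply, advectiveDeriv_apply, gradField_apply, gradField_apply]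
  have hadd : Torus.fderiv (advectiveDeriv T v u t) (proj y) =
      Torus.fderiv (timeDerivWithin (Icc 0 T) u t) (proj y) + Torus.fderiv (convect (v t) (u t)) (proj y) := by
    rw [← fderiv_lift, ← fderiv_lift, ← fderiv_lift]
    have e : lift (advectiveDeriv T v u t) = lift (timeDerivWithin (Icc 0 T) u t) + lift (convect (v t) (u t)) := by
      funext z; rfl
    rw [e]
    exact fderiv_add ((h1.differentiable (by simp)) y) ((h2.differentiable (by simp)) y)
  rw [hadd, fderiv_convect_slice (hu.isSmooth_slice ht) (hv.isSmooth_slice ht), ← add_assoc]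
  congr 1
  have e2 := timeDerivWithin_gradField hT hu ht (proj y)
  rw [gradField_apply] at e2
  rw [← e2]
  rfl

end GradField

/-! ## Slice calculus: lifts, norms of iterated derivatives, products of linear-map fields -/

section SliceCalculus

variable {E₁ E₂ E₃ : Type*} [NormedAddCommGroup E₁] [NormedSpace ℝ E₁]
  [NormedAddCommGroup E₂] [NormedSpace ℝ E₂] [NormedAddCommGroup E₃] [NormedSpace ℝ E₃]

/-- `D(-f) = -Df` on the torus. [folklore] -/
theorem fderiv_neg_slice (f : 𝕋³ → E) (x : 𝕋³) : Torus.fderiv (fun y => -f y) x = -Torus.fderiv f x := by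
  unfold Torus.fderiv
  have h : liftAt (fun y => -f y) x = fun w => -liftAt f x w := rfl
  rw [h, fderiv_fun_neg]

/-- `D(const) = 0` on the torus. [folklore] -/
theorem fderiv_const_slice (c : E) (x : 𝕋³) : Torus.fderiv (fun _ : 𝕋³ => c) x = 0 := by
  unfold Torus.fderiv
  have h : liftAt (fun _ : 𝕋³ => c) x = fun _ => c := rfl
  rw [h, fderiv_const_apply]

/-- `D(f - g) = Df - Dg` on the torus, for smooth slices. [folklore] -/
theorem fderiv_sub_slice {f g : 𝕋³ → E} (hf : IsSmooth f) (hg : IsSmooth g) (x : 𝕋³) :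
    Torus.fderiv (fun y => f y - g y) x = Torus.fderiv f x - Torus.fderiv g x := by
  unfold Torus.fderiv
  have h : liftAt (fun y => f y - g y) x = fun w => liftAt f x w - liftAt g x w := rfl
  rw [h]
  exact fderiv_fun_sub (((hf.liftAt x).differentiable (by simp)) 0) (((hg.liftAt x).differentiable (by simp)) 0)

/-- `‖D⁰(lift f)(y)‖ = ‖f(proj y)‖`. [folklore] -/
theorem norm_iteratedFDeriv_lift_zero (f : 𝕋³ → E) (y : ℝ³) :
    ‖iteratedFDeriv ℝ 0 (lift f) y‖ = ‖f (proj y)‖ := by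
  rw [norm_iteratedFDeriv_zero, lift_apply]

/-- `‖Dᵏ⁺¹(lift f)(y)‖ = ‖Dᵏ(lift ∇f)(y)‖`: one derivative of the lift is absorbed into the
slice gradient. [folklore] -/
theorem norm_iteratedFDeriv_lift_succ (f : 𝕋³ → E) (k : ℕ) (y : ℝ³) :
    ‖iteratedFDeriv ℝ (k + 1) (lift f) y‖ = ‖iteratedFDeriv ℝ k (lift (fun x => Torus.fderiv f x)) y‖ := by
  rw [lift_fderiv_slice, norm_iteratedFDeriv_fderiv]

/-- `‖D¹(lift f)(y)‖ = ‖∇f(proj y)‖`. [folklore] -/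
theorem norm_iteratedFDeriv_lift_one (f : 𝕋³ → E) (y : ℝ³) :
    ‖iteratedFDeriv ℝ 1 (lift f) y‖ = ‖Torus.fderiv f (proj y)‖ := by
  rw [norm_iteratedFDeriv_lift_succ, norm_iteratedFDeriv_lift_zero]

/-- `‖D²(lift f)(y)‖ = ‖∇²f(proj y)‖` with `∇²f = ∇(∇f)`. [folklore] -/
theorem norm_iteratedFDeriv_lift_two (f : 𝕋³ → E) (y : ℝ³) :
    ‖iteratedFDeriv ℝ 2 (lift f) y‖ = ‖Torus.fderiv (fun x => Torus.fderiv f x) (proj y)‖ := by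
  rw [norm_iteratedFDeriv_lift_succ, norm_iteratedFDeriv_lift_one]

/-- `‖D³(lift f)(y)‖ = ‖∇³f(proj y)‖` with `∇³f = ∇(∇(∇f))`. [folklore] -/
theorem norm_iteratedFDeriv_lift_three (f : 𝕋³ → E) (y : ℝ³) :
    ‖iteratedFDeriv ℝ 3 (lift f) y‖ =
      ‖Torus.fderiv (fun x => Torus.fderiv (fun z => Torus.fderiv f z) x) (proj y)‖ := by
  rw [norm_iteratedFDeriv_lift_succ, norm_iteratedFDeriv_lift_two]

/-- **Product rule bound for composed linear-map fields**: for smooth slices `A`, `B` of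
continuous linear maps, `‖∇(A ∘ B)‖ ≤ ‖A‖ ‖∇B‖ + ‖∇A‖ ‖B‖` pointwise. [folklore] -/
theorem norm_fderiv_clm_comp_slice_le {A : 𝕋³ → (E₂ →L[ℝ] E₃)} {B : 𝕋³ → (E₁ →L[ℝ] E₂)}
    (hA : IsSmooth A) (hB : IsSmooth B) (x : 𝕋³) :
    ‖Torus.fderiv (fun y => (A y).comp (B y)) x‖ ≤
      ‖A x‖ * ‖Torus.fderiv B x‖ + ‖Torus.fderiv A x‖ * ‖B x‖ := by
  obtain ⟨y, rfl⟩ := proj_surjective x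
  have hA' : ContDiff ℝ ∞ (lift A) := hA
  have hB' : ContDiff ℝ ∞ (lift B) := hB
  have hfun : lift (fun y => (A y).comp (B y)) =
      fun z => ContinuousLinearMap.compL ℝ E₁ E₂ E₃ (lift A z) (lift B z) := by
    funext z; simp [lift_apply]
  have key := (ContinuousLinearMap.compL ℝ E₁ E₂ E₃).norm_iteratedFDeriv_le_of_bilinear_of_le_one
    hA' hB' y (n := 1) (WithTop.coe_le_coe.2 le_top)
    (ContinuousLinearMap.norm_compL_le ℝ E₁ E₂ E₃)
  rw [← hfun, norm_iteratedFDeriv_lift_one] at key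
  refine key.trans (le_of_eq ?_)
  simp only [Finset.sum_range_succ, Finset.sum_range_zero, zero_add, Nat.choose_zero_right,
    Nat.choose_self, Nat.cast_one, one_mul, Nat.sub_zero, Nat.reduceSub,
    norm_iteratedFDeriv_lift_zero, norm_iteratedFDeriv_lift_one]

/-- **Second-order product rule bound for composed linear-map fields**:
`‖∇²(A ∘ B)‖ ≤ ‖A‖ ‖∇²B‖ + 2 ‖∇A‖ ‖∇B‖ + ‖∇²A‖ ‖B‖` pointwise. [folklore] -/
theorem norm_fderiv_fderiv_clm_comp_slice_le {A : 𝕋³ → (E₂ →L[ℝ] E₃)} {B : 𝕋³ → (E₁ →L[ℝ] E₂)}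
    (hA : IsSmooth A) (hB : IsSmooth B) (x : 𝕋³) :
    ‖Torus.fderiv (fun x' => Torus.fderiv (fun y => (A y).comp (B y)) x') x‖ ≤
      ‖A x‖ * ‖Torus.fderiv (fun x' => Torus.fderiv B x') x‖ +
        2 * ‖Torus.fderiv A x‖ * ‖Torus.fderiv B x‖ +
        ‖Torus.fderiv (fun x' => Torus.fderiv A x') x‖ * ‖B x‖ := by
  obtain ⟨y, rfl⟩ := proj_surjective x
  have hA' : ContDiff ℝ ∞ (lift A) := hA
  have hB' : ContDiff ℝ ∞ (lift B) := hB
  have hfun : lift (fun y => (A y).comp (B y)) =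
      fun z => ContinuousLinearMap.compL ℝ E₁ E₂ E₃ (lift A z) (lift B z) := by
    funext z; simp [lift_apply]
  have key := (ContinuousLinearMap.compL ℝ E₁ E₂ E₃).norm_iteratedFDeriv_le_of_bilinear_of_le_one
    hA' hB' y (n := 2) (WithTop.coe_le_coe.2 le_top)
    (ContinuousLinearMap.norm_compL_le ℝ E₁ E₂ E₃)
  rw [← hfun, norm_iteratedFDeriv_lift_two] at key
  refine key.trans (le_of_eq ?_)
  simp only [Finset.sum_range_succ, Finset.sum_range_zero, zero_add, Nat.choose_zero_right,
    Nat.choose_self, Nat.cast_one, one_mul, Nat.sub_zero, Nat.reduceSub,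
    norm_iteratedFDeriv_lift_zero, norm_iteratedFDeriv_lift_one, norm_iteratedFDeriv_lift_two,
    show Nat.choose 2 1 = 2 from rfl, Nat.cast_ofNat]

/-- `gronwallBound 0 K ε x ≤ ε x e^{Kx}` for `K, ε, x ≥ 0` (`e^{y} - 1 ≤ y e^{y}`). [folklore] -/
theorem gronwallBound_zero_le {K ε x : ℝ} (hK : 0 ≤ K) (hε : 0 ≤ ε) :
    gronwallBound 0 K ε x ≤ ε * x * Real.exp (K * x) := by
  rcases eq_or_lt_of_le hK with rfl | hK'
  · simp [gronwallBound_K0]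
  · rw [gronwallBound_of_K_ne_0 hK'.ne']
    have h1 : Real.exp (K * x) - 1 ≤ K * x * Real.exp (K * x) := by
      have h := Real.add_one_le_exp (-(K * x))
      rw [Real.exp_neg] at h
      have hpos := Real.exp_pos (K * x)
      have := mul_le_mul_of_nonneg_right h hpos.le
      rw [inv_mul_cancel₀ hpos.ne'] at this
      nlinarith
    have h2 : ε / K * (Real.exp (K * x) - 1) ≤ ε / K * (K * x * Real.exp (K * x)) :=
      mul_le_mul_of_nonneg_left h1 (div_nonneg hε hK)
    calc 0 * Real.exp (K * x) + ε / K * (Real.exp (K * x) - 1)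
        ≤ ε / K * (K * x * Real.exp (K * x)) := by rw [zero_mul, zero_add]; exact h2
      _ = ε * x * Real.exp (K * x) := by field_simp

/-- `exp (c x) ≤ N` for `0 ≤ x ≤ 1`, `0 ≤ c` and `exp c ≤ N`. [folklore] -/
theorem exp_mul_le_of_le_one {c x N : ℝ} (hc : 0 ≤ c) (hx : x ≤ 1)
    (hN : Real.exp c ≤ N) : Real.exp (c * x) ≤ N :=
  (Real.exp_le_exp.2 (by nlinarith)).trans hN

/-- `e ≤ 3`. [folklore] -/
theorem exp_one_le_three : Real.exp 1 ≤ 3 := by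
  have := Real.exp_one_lt_d9; norm_num at this; linarith

/-- `e² ≤ 8`. [folklore] -/
theorem exp_two_le_eight : Real.exp 2 ≤ 8 := by
  have h := Real.exp_one_lt_d9
  have h0 := Real.exp_pos 1
  rw [show (2 : ℝ) = 1 + 1 by norm_num, Real.exp_add]
  nlinarith

/-- `e³ ≤ 21`. [folklore] -/
theorem exp_three_le : Real.exp 3 ≤ 21 := by
  have h := Real.exp_one_lt_d9
  have h0 := Real.exp_pos 1
  rw [show (3 : ℝ) = 1 + 1 + 1 by norm_num, Real.exp_add, Real.exp_add]
  nlinarith [mul_pos h0 h0]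

end SliceCalculus

/-! ## (B.4)–(B.5): derivative bounds for transported displacements -/

section FlowBounds

variable {T : ℝ} {v : ℝ → 𝕋³ → ℝ³} {D : ℝ → 𝕋³ → ℝ³} {t₀ : ℝ} {V₁ V₂ V₃ : ℝ}

/-- **(B.4): `‖∇Φ(t) - Id‖₀ ≤ 3 |t - t₀| [v]₁`.** Let `v` be jointly smooth on `[0,T] × T³` with
`‖∇v‖ ≤ V₁` pointwise, and let `D` be jointly smooth with `(∂ₜ + v·∇)D = -v` on `[0,T] × T³` and
`D(t₀, ·) = 0` (i.e. `Φ = id + D` is the backward flow anchored at `t₀`, `∇Φ - Id = ∇D`). Then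
for `|t - t₀| V₁ ≤ 1`, `‖∇D(t, x)‖ ≤ 3 V₁ |t - t₀|`: indeed `(∂ₜ + v·∇)∇D = -∇v - ∇D ∘ ∇v`, so
Grönwall gives `‖∇D(t)‖ ≤ e^{V₁|t-t₀|} - 1`. [cite: BuckmasterEtAl2018, App. B, Prop. B.1 (B.4)] -/
theorem norm_gradField_le (hT : 0 < T) (hv : IsSmoothSpaceTimeOn (Icc 0 T) v)
    (hD : IsSmoothSpaceTimeOn (Icc 0 T) D)
    (htr : ∀ s ∈ Icc 0 T, ∀ x, advectiveDeriv T v D s x = -v s x)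
    (ht₀ : t₀ ∈ Icc 0 T) (h0 : ∀ x, D t₀ x = 0) (hV₁ : 0 ≤ V₁)
    (hb₁ : ∀ s ∈ Icc 0 T, ∀ x, ‖gradField v s x‖ ≤ V₁)
    {t : ℝ} (ht : t ∈ Icc 0 T) (hτ : |t - t₀| * V₁ ≤ 1) (x : 𝕋³) :
    ‖gradField D t x‖ ≤ 3 * V₁ * |t - t₀| := by
  have hS : UniqueDiffOn ℝ (Icc 0 T) := uniqueDiffOn_Icc hT
  have hG : IsSmoothSpaceTimeOn (Icc 0 T) (gradField D) := hD.gradField hS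
  have heq : ∀ s ∈ Icc 0 T, ∀ x, advectiveDeriv T v (gradField D) s x =
      -gradField v s x - (gradField D s x).comp (gradField v s x) := by
    intro s hs x
    have h1 := gradField_advectiveDeriv hT hv hD hs x
    have h2 : gradField (advectiveDeriv T v D) s x = -gradField v s x := by
      have e : advectiveDeriv T v D s = fun x => -v s x := funext (htr s hs)
      rw [gradField_apply, e, fderiv_neg_slice, gradField_apply]
    rw [h2] at h1
    exact eq_sub_of_add_eq h1.symm
  have hbound : ∀ s ∈ uIcc t₀ t, ∀ x,
      ‖advectiveDeriv T v (gradField D) s x‖ ≤ V₁ * ‖gradField D s x‖ + V₁ := by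
    intro s hs x
    have hsS : s ∈ Icc 0 T := (uIcc_subset_Icc ht₀ ht) hs
    rw [heq s hsS x]
    calc ‖-gradField v s x - (gradField D s x).comp (gradField v s x)‖
        ≤ ‖-gradField v s x‖ + ‖(gradField D s x).comp (gradField v s x)‖ := norm_sub_le _ _
      _ ≤ V₁ + ‖gradField D s x‖ * V₁ := by
          rw [norm_neg]
          exact add_le_add (hb₁ s hsS x) (((gradField D s x).opNorm_comp_le _).trans
            (mul_le_mul_of_nonneg_left (hb₁ s hsS x) (norm_nonneg _)))
      _ = V₁ * ‖gradField D s x‖ + V₁ := by ring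
  have hinit : ∀ x, ‖gradField D t₀ x‖ ≤ 0 := by
    intro x
    have e : D t₀ = fun _ => (0 : ℝ³) := funext h0
    rw [gradField_apply, e, fderiv_const_slice, norm_zero]
  have key := norm_le_gronwallBound_of_advectiveDeriv hT hv hG ht₀ ht hinit hbound x
  refine key.trans ((gronwallBound_zero_le hV₁ hV₁).trans ?_)
  have hexp : Real.exp (V₁ * |t - t₀|) ≤ 3 := by
    rw [mul_comm] at hτ
    have := exp_mul_le_of_le_one (c := 1) (x := V₁ * |t - t₀|) zero_le_one hτ exp_one_le_three
    rwa [one_mul] at this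
  have h0' : 0 ≤ V₁ * |t - t₀| := mul_nonneg hV₁ (abs_nonneg _)
  nlinarith

/-- Smooth slices of continuous linear maps compose to a smooth slice. [folklore] -/
theorem isSmooth_clm_comp_slice {E₁ E₂ E₃ : Type*} [NormedAddCommGroup E₁] [NormedSpace ℝ E₁]
    [NormedAddCommGroup E₂] [NormedSpace ℝ E₂] [NormedAddCommGroup E₃] [NormedSpace ℝ E₃]
    {A : 𝕋³ → (E₂ →L[ℝ] E₃)} {B : 𝕋³ → (E₁ →L[ℝ] E₂)} (hA : IsSmooth A) (hB : IsSmooth B) :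
    IsSmooth (fun y => (A y).comp (B y)) := by
  have hA' : ContDiff ℝ ∞ (lift A) := hA
  have hB' : ContDiff ℝ ∞ (lift B) := hB
  exact hA'.clm_comp hB'

/-- The transport equation of `∇D`: `(∂ₜ + v·∇)∇D = -∇v - ∇D ∘ ∇v` when `(∂ₜ + v·∇)D = -v`.
[cite: BuckmasterEtAl2018, App. B, Prop. B.1 (B.4)] -/
theorem advectiveDeriv_gradField_eq (hT : 0 < T) (hv : IsSmoothSpaceTimeOn (Icc 0 T) v)
    (hD : IsSmoothSpaceTimeOn (Icc 0 T) D)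
    (htr : ∀ s ∈ Icc 0 T, ∀ x, advectiveDeriv T v D s x = -v s x) {s : ℝ} (hs : s ∈ Icc 0 T)
    (x : 𝕋³) :
    advectiveDeriv T v (gradField D) s x =
      -gradField v s x - (gradField D s x).comp (gradField v s x) := by
  have h1 := gradField_advectiveDeriv hT hv hD hs x
  have h2 : gradField (advectiveDeriv T v D) s x = -gradField v s x := by
    have e : advectiveDeriv T v D s = fun x => -v s x := funext (htr s hs)
    rw [gradField_apply, e, fderiv_neg_slice, gradField_apply]
  rw [h2] at h1
  exact eq_sub_of_add_eq h1.symm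

/-- The transport equation of `∇²D`:
`(∂ₜ + v·∇)∇²D = -∇²v - ∇(∇D ∘ ∇v) - ∇²D ∘ ∇v` when `(∂ₜ + v·∇)D = -v`.
[cite: BuckmasterEtAl2018, App. B, Prop. B.1 (B.5)] -/
theorem advectiveDeriv_gradField_two_eq (hT : 0 < T) (hv : IsSmoothSpaceTimeOn (Icc 0 T) v)
    (hD : IsSmoothSpaceTimeOn (Icc 0 T) D)
    (htr : ∀ s ∈ Icc 0 T, ∀ x, advectiveDeriv T v D s x = -v s x) {s : ℝ} (hs : s ∈ Icc 0 T)
    (x : 𝕋³) :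
    advectiveDeriv T v (gradField (gradField D)) s x =
      -gradField (gradField v) s x
        - Torus.fderiv (fun y => (gradField D s y).comp (gradField v s y)) x
        - (gradField (gradField D) s x).comp (gradField v s x) := by
  have hS : UniqueDiffOn ℝ (Icc 0 T) := uniqueDiffOn_Icc hT
  have hG₁ : IsSmoothSpaceTimeOn (Icc 0 T) (gradField D) := hD.gradField hS
  have hW₁ : IsSmoothSpaceTimeOn (Icc 0 T) (gradField v) := hv.gradField hS
  have h1 := gradField_advectiveDeriv hT hv hG₁ hs x
  have e : advectiveDeriv T v (gradField D) s =
      fun y => -gradField v s y - (gradField D s y).comp (gradField v s y) :=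
    funext fun y => advectiveDeriv_gradField_eq hT hv hD htr hs y
  have h2 : gradField (advectiveDeriv T v (gradField D)) s x =
      -gradField (gradField v) s x
        - Torus.fderiv (fun y => (gradField D s y).comp (gradField v s y)) x := by
    rw [gradField_apply, e]
    have hn : IsSmooth (fun y => -gradField v s y) := (hW₁.isSmooth_slice hs).neg
    have hc : IsSmooth (fun y => (gradField D s y).comp (gradField v s y)) :=
      isSmooth_clm_comp_slice (hG₁.isSmooth_slice hs) (hW₁.isSmooth_slice hs)
    rw [fderiv_sub_slice hn hc, fderiv_neg_slice]
    rfl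
  rw [h2] at h1
  exact eq_sub_of_add_eq h1.symm

/-- **(B.5), `N = 2`: `‖∇²Φ(t)‖₀ ≤ 32 |t - t₀| [v]₂`** under `|t - t₀| [v]₁ ≤ 1`, for the
backward flow `Φ = id + D` as in `BDSV.norm_gradField_le`, with `‖∇²v‖ ≤ V₂` pointwise:
`(∂ₜ + v·∇)∇²D = -∇²v - ∇(∇D∘∇v) - ∇²D∘∇v` has forcing `≤ 4V₂` and linear part `≤ 2V₁‖∇²D‖`,
so Grönwall gives `‖∇²D(t)‖ ≤ 4V₂|t-t₀| e^{2V₁|t-t₀|}`. [cite: BuckmasterEtAl2018, App. B, Prop. B.1 (B.5)] -/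
theorem norm_gradField_two_le (hT : 0 < T) (hv : IsSmoothSpaceTimeOn (Icc 0 T) v)
    (hD : IsSmoothSpaceTimeOn (Icc 0 T) D)
    (htr : ∀ s ∈ Icc 0 T, ∀ x, advectiveDeriv T v D s x = -v s x)
    (ht₀ : t₀ ∈ Icc 0 T) (h0 : ∀ x, D t₀ x = 0) (hV₁ : 0 ≤ V₁) (hV₂ : 0 ≤ V₂)
    (hb₁ : ∀ s ∈ Icc 0 T, ∀ x, ‖gradField v s x‖ ≤ V₁)
    (hb₂ : ∀ s ∈ Icc 0 T, ∀ x, ‖gradField (gradField v) s x‖ ≤ V₂)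
    {t : ℝ} (ht : t ∈ Icc 0 T) (hτ : |t - t₀| * V₁ ≤ 1) (x : 𝕋³) :
    ‖gradField (gradField D) t x‖ ≤ 32 * V₂ * |t - t₀| := by
  have hS : UniqueDiffOn ℝ (Icc 0 T) := uniqueDiffOn_Icc hT
  have hG₁ : IsSmoothSpaceTimeOn (Icc 0 T) (gradField D) := hD.gradField hS
  have hG₂ : IsSmoothSpaceTimeOn (Icc 0 T) (gradField (gradField D)) := hG₁.gradField hS
  have hW₁ : IsSmoothSpaceTimeOn (Icc 0 T) (gradField v) := hv.gradField hS
  -- the bound on `∇D` between `t₀` and `t`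
  have hB₁ : ∀ s ∈ uIcc t₀ t, ∀ x, ‖gradField D s x‖ ≤ 3 := by
    intro s hs x
    have hsS : s ∈ Icc 0 T := (uIcc_subset_Icc ht₀ ht) hs
    have hs' : |s - t₀| ≤ |t - t₀| := abs_sub_left_of_mem_uIcc hs
    have hsτ : |s - t₀| * V₁ ≤ 1 := (mul_le_mul_of_nonneg_right hs' hV₁).trans hτ
    refine (norm_gradField_le hT hv hD htr ht₀ h0 hV₁ hb₁ hsS hsτ x).trans ?_
    nlinarith [abs_nonneg (s - t₀)]
  have hbound : ∀ s ∈ uIcc t₀ t, ∀ x,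
      ‖advectiveDeriv T v (gradField (gradField D)) s x‖ ≤
        2 * V₁ * ‖gradField (gradField D) s x‖ + 4 * V₂ := by
    intro s hs x
    have hsS : s ∈ Icc 0 T := (uIcc_subset_Icc ht₀ ht) hs
    rw [advectiveDeriv_gradField_two_eq hT hv hD htr hsS x]
    have e1 : ‖gradField (gradField v) s x‖ ≤ V₂ := hb₂ s hsS x
    have e2 : ‖Torus.fderiv (fun y => (gradField D s y).comp (gradField v s y)) x‖ ≤
        3 * V₂ + ‖gradField (gradField D) s x‖ * V₁ := by
      refine (norm_fderiv_clm_comp_slice_le (hG₁.isSmooth_slice hsS) (hW₁.isSmooth_slice hsS) x).trans ?_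
      refine add_le_add (mul_le_mul (hB₁ s hs x) (hb₂ s hsS x) (norm_nonneg _) (by norm_num)) ?_
      exact mul_le_mul_of_nonneg_left (hb₁ s hsS x) (norm_nonneg _)
    have e3 : ‖(gradField (gradField D) s x).comp (gradField v s x)‖ ≤
        ‖gradField (gradField D) s x‖ * V₁ :=
      ((gradField (gradField D) s x).opNorm_comp_le _).trans
        (mul_le_mul_of_nonneg_left (hb₁ s hsS x) (norm_nonneg _))
    calc ‖-gradField (gradField v) s x
            - Torus.fderiv (fun y => (gradField D s y).comp (gradField v s y)) x
            - (gradField (gradField D) s x).comp (gradField v s x)‖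
        ≤ ‖gradField (gradField v) s x‖
            + ‖Torus.fderiv (fun y => (gradField D s y).comp (gradField v s y)) x‖
            + ‖(gradField (gradField D) s x).comp (gradField v s x)‖ := by
          refine (norm_sub_le _ _).trans (add_le_add ((norm_sub_le _ _).trans ?_) le_rfl)
          rw [norm_neg]
      _ ≤ V₂ + (3 * V₂ + ‖gradField (gradField D) s x‖ * V₁)
            + ‖gradField (gradField D) s x‖ * V₁ := add_le_add (add_le_add e1 e2) e3
      _ = 2 * V₁ * ‖gradField (gradField D) s x‖ + 4 * V₂ := by ring
  have hinit : ∀ x, ‖gradField (gradField D) t₀ x‖ ≤ 0 := by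
    intro x
    have e : gradField D t₀ = fun _ => (0 : ℝ³ →L[ℝ] ℝ³) := by
      funext z
      have e0 : D t₀ = fun _ => (0 : ℝ³) := funext h0
      rw [gradField_apply, e0, fderiv_const_slice]
    rw [gradField_apply, e, fderiv_const_slice, norm_zero]
  have key := norm_le_gronwallBound_of_advectiveDeriv hT hv hG₂ ht₀ ht hinit hbound x
  refine key.trans ((gronwallBound_zero_le (by positivity) (by positivity)).trans ?_)
  have hexp : Real.exp (2 * V₁ * |t - t₀|) ≤ 8 := by
    have := exp_mul_le_of_le_one (c := 2) (x := |t - t₀| * V₁) zero_le_two hτ exp_two_le_eight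
    rwa [show (2 : ℝ) * (|t - t₀| * V₁) = 2 * V₁ * |t - t₀| by ring] at this
  have h0' : 0 ≤ V₂ * |t - t₀| := mul_nonneg hV₂ (abs_nonneg _)
  nlinarith

set_option maxHeartbeats 800000 in
/-- **(B.5), `N = 3`: `‖∇³Φ(t)‖₀ ≤ 2100 (V₃ + V₂²|t - t₀|) |t - t₀|`** under `|t - t₀| [v]₁ ≤ 1`,
for the backward flow `Φ = id + D` as in `BDSV.norm_gradField_le`, with `‖∇ᵏv‖ ≤ V_k`:
`(∂ₜ + v·∇)∇³D = -∇³v - ∇²(∇D∘∇v) - ∇(∇²D∘∇v) - ∇³D∘∇v` has linear part `≤ 3V₁‖∇³D‖` and forcing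
`≤ 4V₃ + 96 V₂²|t - t₀|` (the source states `[Φ]₃ ≲ |t|[v]₃` after interpolating `[v]₂² ≤ [v]₁[v]₃`;
the un-interpolated form suffices downstream). [cite: BuckmasterEtAl2018, App. B, Prop. B.1 (B.5)] -/
theorem norm_gradField_three_le (hT : 0 < T) (hv : IsSmoothSpaceTimeOn (Icc 0 T) v)
    (hD : IsSmoothSpaceTimeOn (Icc 0 T) D)
    (htr : ∀ s ∈ Icc 0 T, ∀ x, advectiveDeriv T v D s x = -v s x)
    (ht₀ : t₀ ∈ Icc 0 T) (h0 : ∀ x, D t₀ x = 0) (hV₁ : 0 ≤ V₁) (hV₂ : 0 ≤ V₂) (hV₃ : 0 ≤ V₃)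
    (hb₁ : ∀ s ∈ Icc 0 T, ∀ x, ‖gradField v s x‖ ≤ V₁)
    (hb₂ : ∀ s ∈ Icc 0 T, ∀ x, ‖gradField (gradField v) s x‖ ≤ V₂)
    (hb₃ : ∀ s ∈ Icc 0 T, ∀ x, ‖gradField (gradField (gradField v)) s x‖ ≤ V₃)
    {t : ℝ} (ht : t ∈ Icc 0 T) (hτ : |t - t₀| * V₁ ≤ 1) (x : 𝕋³) :
    ‖gradField (gradField (gradField D)) t x‖ ≤ 2100 * (V₃ + V₂ ^ 2 * |t - t₀|) * |t - t₀| := by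
  have hS : UniqueDiffOn ℝ (Icc 0 T) := uniqueDiffOn_Icc hT
  have hG₁ : IsSmoothSpaceTimeOn (Icc 0 T) (gradField D) := hD.gradField hS
  have hG₂ : IsSmoothSpaceTimeOn (Icc 0 T) (gradField (gradField D)) := hG₁.gradField hS
  have hG₃ : IsSmoothSpaceTimeOn (Icc 0 T) (gradField (gradField (gradField D))) := hG₂.gradField hS
  have hW₁ : IsSmoothSpaceTimeOn (Icc 0 T) (gradField v) := hv.gradField hS
  have hW₂ : IsSmoothSpaceTimeOn (Icc 0 T) (gradField (gradField v)) := hW₁.gradField hS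
  set τ : ℝ := |t - t₀| with hτdef
  -- bounds on `∇D`, `∇²D` between `t₀` and `t`
  have hB₁ : ∀ s ∈ uIcc t₀ t, ∀ x, ‖gradField D s x‖ ≤ 3 := by
    intro s hs x
    have hsS : s ∈ Icc 0 T := (uIcc_subset_Icc ht₀ ht) hs
    have hs' : |s - t₀| ≤ |t - t₀| := abs_sub_left_of_mem_uIcc hs
    have hsτ : |s - t₀| * V₁ ≤ 1 := (mul_le_mul_of_nonneg_right hs' hV₁).trans hτ
    refine (norm_gradField_le hT hv hD htr ht₀ h0 hV₁ hb₁ hsS hsτ x).trans ?_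
    nlinarith [abs_nonneg (s - t₀)]
  have hB₂ : ∀ s ∈ uIcc t₀ t, ∀ x, ‖gradField (gradField D) s x‖ ≤ 32 * V₂ * τ := by
    intro s hs x
    have hsS : s ∈ Icc 0 T := (uIcc_subset_Icc ht₀ ht) hs
    have hs' : |s - t₀| ≤ |t - t₀| := abs_sub_left_of_mem_uIcc hs
    have hsτ : |s - t₀| * V₁ ≤ 1 := (mul_le_mul_of_nonneg_right hs' hV₁).trans hτ
    refine (norm_gradField_two_le hT hv hD htr ht₀ h0 hV₁ hV₂ hb₁ hb₂ hsS hsτ x).trans ?_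
    exact mul_le_mul_of_nonneg_left hs' (by positivity)
  -- the transport equation of `∇³D` and its bound
  have hbound : ∀ s ∈ uIcc t₀ t, ∀ x,
      ‖advectiveDeriv T v (gradField (gradField (gradField D))) s x‖ ≤
        3 * V₁ * ‖gradField (gradField (gradField D)) s x‖ + (4 * V₃ + 96 * V₂ ^ 2 * τ) := by
    intro s hs x
    have hsS : s ∈ Icc 0 T := (uIcc_subset_Icc ht₀ ht) hs
    -- slices at time `s`
    have sG₁ : IsSmooth (gradField D s) := hG₁.isSmooth_slice hsS
    have sG₂ : IsSmooth (gradField (gradField D) s) := hG₂.isSmooth_slice hsS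
    have sW₁ : IsSmooth (gradField v s) := hW₁.isSmooth_slice hsS
    have sW₂ : IsSmooth (gradField (gradField v) s) := hW₂.isSmooth_slice hsS
    have sQ : IsSmooth (fun y => Torus.fderiv (fun z => (gradField D s z).comp (gradField v s z)) y) :=
      (isSmooth_clm_comp_slice sG₁ sW₁).fderiv_slice
    have sC : IsSmooth (fun y => (gradField (gradField D) s y).comp (gradField v s y)) :=
      isSmooth_clm_comp_slice sG₂ sW₁
    -- the equation
    have h1 := gradField_advectiveDeriv hT hv hG₂ hsS x
    have e : advectiveDeriv T v (gradField (gradField D)) s = fun y =>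
        -gradField (gradField v) s y
          - Torus.fderiv (fun z => (gradField D s z).comp (gradField v s z)) y
          - (gradField (gradField D) s y).comp (gradField v s y) :=
      funext fun y => advectiveDeriv_gradField_two_eq hT hv hD htr hsS y
    have h2 : gradField (advectiveDeriv T v (gradField (gradField D))) s x =
        -gradField (gradField (gradField v)) s x
          - Torus.fderiv (fun y => Torus.fderiv (fun z => (gradField D s z).comp (gradField v s z)) y) x
          - Torus.fderiv (fun y => (gradField (gradField D) s y).comp (gradField v s y)) x := by
      rw [gradField_apply, e]
      have hn : IsSmooth (fun y => -gradField (gradField v) s y) := sW₂.neg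
      have hnq : IsSmooth (fun y => -gradField (gradField v) s y
          - Torus.fderiv (fun z => (gradField D s z).comp (gradField v s z)) y) := hn.sub sQ
      rw [fderiv_sub_slice hnq sC, fderiv_sub_slice hn sQ, fderiv_neg_slice]
      rfl
    rw [h2] at h1
    have heq : advectiveDeriv T v (gradField (gradField (gradField D))) s x =
        -gradField (gradField (gradField v)) s x
          - Torus.fderiv (fun y => Torus.fderiv (fun z => (gradField D s z).comp (gradField v s z)) y) x
          - Torus.fderiv (fun y => (gradField (gradField D) s y).comp (gradField v s y)) x
          - (gradField (gradField (gradField D)) s x).comp (gradField v s x) :=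
      eq_sub_of_add_eq h1.symm
    rw [heq]
    -- the four bounds
    have e1 : ‖gradField (gradField (gradField v)) s x‖ ≤ V₃ := hb₃ s hsS x
    have e2 : ‖Torus.fderiv (fun y => Torus.fderiv (fun z => (gradField D s z).comp (gradField v s z)) y) x‖ ≤
        3 * V₃ + 2 * (32 * V₂ * τ) * V₂ + ‖gradField (gradField (gradField D)) s x‖ * V₁ := by
      refine (norm_fderiv_fderiv_clm_comp_slice_le sG₁ sW₁ x).trans ?_
      refine add_le_add (add_le_add ?_ ?_) ?_
      · exact mul_le_mul (hB₁ s hs x) (hb₃ s hsS x) (norm_nonneg _) (by norm_num)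
      · rw [mul_assoc, mul_assoc]
        refine mul_le_mul_of_nonneg_left ?_ (by norm_num)
        exact mul_le_mul (hB₂ s hs x) (hb₂ s hsS x) (norm_nonneg _) (by positivity)
      · exact mul_le_mul_of_nonneg_left (hb₁ s hsS x) (norm_nonneg _)
    have e3 : ‖Torus.fderiv (fun y => (gradField (gradField D) s y).comp (gradField v s y)) x‖ ≤
        32 * V₂ * τ * V₂ + ‖gradField (gradField (gradField D)) s x‖ * V₁ := by
      refine (norm_fderiv_clm_comp_slice_le sG₂ sW₁ x).trans ?_
      refine add_le_add (mul_le_mul (hB₂ s hs x) (hb₂ s hsS x) (norm_nonneg _) (by positivity)) ?_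
      exact mul_le_mul_of_nonneg_left (hb₁ s hsS x) (norm_nonneg _)
    have e4 : ‖(gradField (gradField (gradField D)) s x).comp (gradField v s x)‖ ≤
        ‖gradField (gradField (gradField D)) s x‖ * V₁ :=
      ((gradField (gradField (gradField D)) s x).opNorm_comp_le _).trans
        (mul_le_mul_of_nonneg_left (hb₁ s hsS x) (norm_nonneg _))
    calc ‖-gradField (gradField (gradField v)) s x
          - Torus.fderiv (fun y => Torus.fderiv (fun z => (gradField D s z).comp (gradField v s z)) y) x
          - Torus.fderiv (fun y => (gradField (gradField D) s y).comp (gradField v s y)) x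
          - (gradField (gradField (gradField D)) s x).comp (gradField v s x)‖
        ≤ ‖gradField (gradField (gradField v)) s x‖
          + ‖Torus.fderiv (fun y => Torus.fderiv (fun z => (gradField D s z).comp (gradField v s z)) y) x‖
          + ‖Torus.fderiv (fun y => (gradField (gradField D) s y).comp (gradField v s y)) x‖
          + ‖(gradField (gradField (gradField D)) s x).comp (gradField v s x)‖ := by
          refine (norm_sub_le _ _).trans (add_le_add ((norm_sub_le _ _).trans
            (add_le_add ((norm_sub_le _ _).trans ?_) le_rfl)) le_rfl)
          rw [norm_neg]
      _ ≤ V₃ + (3 * V₃ + 2 * (32 * V₂ * τ) * V₂ + ‖gradField (gradField (gradField D)) s x‖ * V₁)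
          + (32 * V₂ * τ * V₂ + ‖gradField (gradField (gradField D)) s x‖ * V₁)
          + ‖gradField (gradField (gradField D)) s x‖ * V₁ :=
          add_le_add (add_le_add (add_le_add e1 e2) e3) e4
      _ = 3 * V₁ * ‖gradField (gradField (gradField D)) s x‖ + (4 * V₃ + 96 * V₂ ^ 2 * τ) := by ring
  have hinit : ∀ x, ‖gradField (gradField (gradField D)) t₀ x‖ ≤ 0 := by
    intro x
    have e0 : D t₀ = fun _ => (0 : ℝ³) := funext h0
    have e1 : gradField D t₀ = fun _ => (0 : ℝ³ →L[ℝ] ℝ³) := by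
      funext z; rw [gradField_apply, e0, fderiv_const_slice]
    have e2 : gradField (gradField D) t₀ = fun _ => (0 : ℝ³ →L[ℝ] ℝ³ →L[ℝ] ℝ³) := by
      funext z; rw [gradField_apply, e1, fderiv_const_slice]
    rw [gradField_apply, e2, fderiv_const_slice, norm_zero]
  have key := norm_le_gronwallBound_of_advectiveDeriv hT hv hG₃ ht₀ ht hinit hbound x
  have hε : 0 ≤ 4 * V₃ + 96 * V₂ ^ 2 * τ := by positivity
  refine key.trans ((gronwallBound_zero_le (by positivity) hε).trans ?_)
  have hexp : Real.exp (3 * V₁ * |t - t₀|) ≤ 21 := by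
    have := exp_mul_le_of_le_one (c := 3) (x := |t - t₀| * V₁) zero_le_three hτ exp_three_le
    rwa [show (3 : ℝ) * (|t - t₀| * V₁) = 3 * V₁ * |t - t₀| by ring] at this
  have h0' : 0 ≤ (4 * V₃ + 96 * V₂ ^ 2 * τ) * |t - t₀| := mul_nonneg hε (abs_nonneg _)
  have hτ0 : 0 ≤ τ := abs_nonneg _
  rw [← hτdef] at hexp h0' ⊢
  calc (4 * V₃ + 96 * V₂ ^ 2 * τ) * τ * Real.exp (3 * V₁ * τ)
      ≤ (4 * V₃ + 96 * V₂ ^ 2 * τ) * τ * 21 := mul_le_mul_of_nonneg_left hexp h0'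
    _ ≤ 2100 * (V₃ + V₂ ^ 2 * τ) * τ := by
        nlinarith [mul_nonneg hV₃ hτ0, mul_nonneg (mul_nonneg (sq_nonneg V₂) hτ0) hτ0]

/-! ### Repackaging through `iteratedFDeriv` of the lifts, and backward flows -/

/-- From `‖D¹(lift (u s))‖ ≤ V` to `‖∇u(s, ·)‖ ≤ V`. [folklore] -/
theorem forall_norm_gradField_le_of_lift {u : ℝ → 𝕋³ → E} {S : Set ℝ} {V : ℝ}
    (h : ∀ s ∈ S, ∀ y, ‖iteratedFDeriv ℝ 1 (lift (u s)) y‖ ≤ V) :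
    ∀ s ∈ S, ∀ x, ‖gradField u s x‖ ≤ V := by
  intro s hs x
  obtain ⟨y, rfl⟩ := proj_surjective x
  have := h s hs y
  rwa [norm_iteratedFDeriv_lift_one] at this

/-- From `‖D²(lift (u s))‖ ≤ V` to `‖∇²u(s, ·)‖ ≤ V`. [folklore] -/
theorem forall_norm_gradField_two_le_of_lift {u : ℝ → 𝕋³ → E} {S : Set ℝ} {V : ℝ}
    (h : ∀ s ∈ S, ∀ y, ‖iteratedFDeriv ℝ 2 (lift (u s)) y‖ ≤ V) :
    ∀ s ∈ S, ∀ x, ‖gradField (gradField u) s x‖ ≤ V := by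
  intro s hs x
  obtain ⟨y, rfl⟩ := proj_surjective x
  have := h s hs y
  rwa [norm_iteratedFDeriv_lift_two] at this

/-- From `‖D³(lift (u s))‖ ≤ V` to `‖∇³u(s, ·)‖ ≤ V`. [folklore] -/
theorem forall_norm_gradField_three_le_of_lift {u : ℝ → 𝕋³ → E} {S : Set ℝ} {V : ℝ}
    (h : ∀ s ∈ S, ∀ y, ‖iteratedFDeriv ℝ 3 (lift (u s)) y‖ ≤ V) :
    ∀ s ∈ S, ∀ x, ‖gradField (gradField (gradField u)) s x‖ ≤ V := by
  intro s hs x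
  obtain ⟨y, rfl⟩ := proj_surjective x
  have := h s hs y
  rwa [norm_iteratedFDeriv_lift_three] at this

/-- **Prop. B.1, (B.4)–(B.5) with `N ≤ 3`, for transported displacements, in terms of the
derivatives of the lifts.** Let `v` be jointly smooth on `[0,T] × T³` with
`‖Dᵏ(lift v(s))‖ ≤ V_k` (`k = 1, 2, 3`) on `[0,T] × ℝ³`, and `D` jointly smooth with
`(∂ₜ + v·∇)D = -v`, `D(t₀, ·) = 0` (`Φ = id + D` the backward flow anchored at `t₀ ∈ [0,T]`).
Then for `t ∈ [0,T]` with `|t - t₀| V₁ ≤ 1` and all `y`: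
`‖D¹(lift D(t))(y)‖ ≤ 3V₁|t - t₀|`, `‖D²(lift D(t))(y)‖ ≤ 32V₂|t - t₀|`,
`‖D³(lift D(t))(y)‖ ≤ 2100(V₃ + V₂²|t - t₀|)|t - t₀|`. [cite: BuckmasterEtAl2018, App. B, Prop. B.1 (B.4)–(B.5)] -/
theorem norm_iteratedFDeriv_lift_le_of_transport (hT : 0 < T) (hv : IsSmoothSpaceTimeOn (Icc 0 T) v)
    (hD : IsSmoothSpaceTimeOn (Icc 0 T) D)
    (htr : ∀ s ∈ Icc 0 T, ∀ x, advectiveDeriv T v D s x = -v s x)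
    (ht₀ : t₀ ∈ Icc 0 T) (h0 : ∀ x, D t₀ x = 0) (hV₁ : 0 ≤ V₁) (hV₂ : 0 ≤ V₂) (hV₃ : 0 ≤ V₃)
    (hb₁ : ∀ s ∈ Icc 0 T, ∀ y, ‖iteratedFDeriv ℝ 1 (lift (v s)) y‖ ≤ V₁)
    (hb₂ : ∀ s ∈ Icc 0 T, ∀ y, ‖iteratedFDeriv ℝ 2 (lift (v s)) y‖ ≤ V₂)
    (hb₃ : ∀ s ∈ Icc 0 T, ∀ y, ‖iteratedFDeriv ℝ 3 (lift (v s)) y‖ ≤ V₃)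
    {t : ℝ} (ht : t ∈ Icc 0 T) (hτ : |t - t₀| * V₁ ≤ 1) (y : ℝ³) :
    ‖iteratedFDeriv ℝ 1 (lift (D t)) y‖ ≤ 3 * V₁ * |t - t₀| ∧
      ‖iteratedFDeriv ℝ 2 (lift (D t)) y‖ ≤ 32 * V₂ * |t - t₀| ∧
      ‖iteratedFDeriv ℝ 3 (lift (D t)) y‖ ≤ 2100 * (V₃ + V₂ ^ 2 * |t - t₀|) * |t - t₀| := by
  have hb₁' := forall_norm_gradField_le_of_lift hb₁
  have hb₂' := forall_norm_gradField_two_le_of_lift hb₂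
  have hb₃' := forall_norm_gradField_three_le_of_lift hb₃
  refine ⟨?_, ?_, ?_⟩
  · rw [norm_iteratedFDeriv_lift_one]
    exact norm_gradField_le hT hv hD htr ht₀ h0 hV₁ hb₁' ht hτ _
  · rw [norm_iteratedFDeriv_lift_two]
    exact norm_gradField_two_le hT hv hD htr ht₀ h0 hV₁ hV₂ hb₁' hb₂' ht hτ _
  · rw [norm_iteratedFDeriv_lift_three]
    exact norm_gradField_three_le hT hv hD htr ht₀ h0 hV₁ hV₂ hV₃ hb₁' hb₂' hb₃' ht hτ _

/-- A `BDSV.FlowDisplacement` solves `(∂ₜ + v·∇)D = -v` on `[0,T] × T³`. [folklore] -/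
theorem FlowDisplacement.advectiveDeriv_eq {t₀ : ℝ} (𝒟 : FlowDisplacement T v t₀) {s : ℝ}
    (hs : s ∈ Icc 0 T) (x : 𝕋³) : advectiveDeriv T v 𝒟.D s x = -v s x :=
  eq_neg_of_add_eq_zero_left (𝒟.transport s hs x)

/-- **Prop. B.1, (B.4)–(B.5) with `N ≤ 3`, for the backward flows `Φᵢ = id + Dᵢ` of §5.2**
(`BDSV.FlowDisplacement`): with `‖Dᵏ(lift v̄(s))‖ ≤ V_k` on `[0,T]` (`k = 1, 2, 3`) and
`|t - t₀| V₁ ≤ 1`, `‖D¹(lift Dᵢ(t))‖ ≤ 3V₁|t - t₀|`, `‖D²(lift Dᵢ(t))‖ ≤ 32V₂|t - t₀|`,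
`‖D³(lift Dᵢ(t))‖ ≤ 2100(V₃ + V₂²|t - t₀|)|t - t₀|` — the inputs of Lemma 5.4 (5.12)
(`‖∇Φᵢ - Id‖₀ ≲ τ_q δ_q^{1/2} λ_q = ℓ^{2α}`) and of Prop. 5.7 (5.29).
[cite: BuckmasterEtAl2018, App. B, Prop. B.1 (B.4)–(B.5); Lemma 5.4 (5.12)] -/
theorem FlowDisplacement.norm_iteratedFDeriv_lift_le (hT : 0 < T)
    (hv : IsSmoothSpaceTimeOn (Icc 0 T) v) (ht₀ : t₀ ∈ Icc 0 T) (𝒟 : FlowDisplacement T v t₀)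
    (hV₁ : 0 ≤ V₁) (hV₂ : 0 ≤ V₂) (hV₃ : 0 ≤ V₃)
    (hb₁ : ∀ s ∈ Icc 0 T, ∀ y, ‖iteratedFDeriv ℝ 1 (lift (v s)) y‖ ≤ V₁)
    (hb₂ : ∀ s ∈ Icc 0 T, ∀ y, ‖iteratedFDeriv ℝ 2 (lift (v s)) y‖ ≤ V₂)
    (hb₃ : ∀ s ∈ Icc 0 T, ∀ y, ‖iteratedFDeriv ℝ 3 (lift (v s)) y‖ ≤ V₃)
    {t : ℝ} (ht : t ∈ Icc 0 T) (hτ : |t - t₀| * V₁ ≤ 1) (y : ℝ³) :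
    ‖iteratedFDeriv ℝ 1 (lift (𝒟.D t)) y‖ ≤ 3 * V₁ * |t - t₀| ∧
      ‖iteratedFDeriv ℝ 2 (lift (𝒟.D t)) y‖ ≤ 32 * V₂ * |t - t₀| ∧
      ‖iteratedFDeriv ℝ 3 (lift (𝒟.D t)) y‖ ≤ 2100 * (V₃ + V₂ ^ 2 * |t - t₀|) * |t - t₀| :=
  norm_iteratedFDeriv_lift_le_of_transport hT hv 𝒟.smooth (fun _ hs x => 𝒟.advectiveDeriv_eq hs x)
    ht₀ 𝒟.anchor hV₁ hV₂ hV₃ hb₁ hb₂ hb₃ ht hτ y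

end FlowBounds

end BDSV

end Literature.Analysis.FluidPDE
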